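import Literature.Analysis.PDE.EvansKrylovInteriorAux
import Literature.Analysis.PDE.EvansKrylovSecondDifferential
import Literature.Analysis.PDE.EvansKrylovSupersolution
import Literature.Analysis.PDE.EvansKrylovCoupling
import Literature.Analysis.PDE.EvansKrylovHolder
import Literature.Analysis.PDE.EvansKrylovOscillation
import HarnessLib

/-!
# The Evans–Krylov interior `C^{2,α}` estimate (Gilbarg–Trudinger Theorem 17.14), a-priori form
# in coordinate jets

The interior Hölder estimate for the second derivatives of solutions of concave fully nonlinear
uniformly elliptic equations, in the uniform ("constants first") form used along sequences of
solutions: for parameters `n, λ ≤ Λ, μ, K, R₀, δ₀` there are `α ∈ (0,1)` and `B` such that every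
`u ∈ C⁴(O)` solving `F(y, θ, cjet₂u(y)) = 0` on an open `O ⊇ B̄(y₀,R₀)` with `F ∈ C²`,

* derivatives of orders `≤ 2` bounded by `K` on `B̄(y₀,R₀)`,
* `‖DF‖ ≤ μ` at all jets `(z, θ, J)`, `z ∈ B̄(y₀,R₀)`, `‖J‖ ≤ K`, and `‖D²F‖ ≤ μ` at the jets of `u`,
* uniform ellipticity `λ|ξ|² ≤ DF(jet)[(0,0,topJet ξ⊗ξ)] ≤ Λ|ξ|²` (Gilbarg–Trudinger (17.43)),
* concavity of `F` in the top slot at the jets of `u` (`D²F[(0,0,topJet Ω)]² ≤ 0`, Ω symmetric)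
  and the supporting-hyperplane inequality at the hybrid jets `(y, u(y), Du(y), D²u(x))` for
  `|x − y| ≤ δ₀` (the two uses of hypothesis (ii)' in the printed proof),

satisfies `[D²u]_{α; B(y₀,R₀/2)} ≤ B` (`evansKrylov_interior_holder`).

The proof is Gilbarg–Trudinger's (§17.4, pp. 457–461 of the 2001 printing), assembled from the
bricks of this directory: the Evans–Krylov direction set (Motzkin–Wasow, Lemma 17.13,
`exists_ek_directions`), the twice differentiated equation
(`pair_symbolMatrix_hessian_quadHess_ge`, (17.44)–(17.46)), the supersolutions
`w_k = h_k + ε Σ h_l²` (`supersolution_w`, (17.47)–(17.48)), the coupling through concavity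
(`coupling_bound`, `sum_mul_quadHess_sub_eq_fderiv`), the oscillation decay from the weak Harnack
inequality (`oscillation_decay`, (17.49)–(17.51)), the choice `ε = (1−δ)/2C`, and the Hölder
conclusion through Lemma 8.23 (`holderOnWith_of_oscSum_decay`,
`holderOnWith_iteratedFDeriv_two_of_quadHess`). Everything here is proved.

## References

* D. Gilbarg, N. S. Trudinger, *Elliptic Partial Differential Equations of Second Order* (2001),
  §17.4, Theorem 17.14 and its proof, Lemma 17.13, Lemma 8.23, Theorem 9.22. [GilbargTrudinger2001]
-/

noncomputable section

open Matrix Finset Metric Set NNReal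
open scoped Topology

namespace Literature.Analysis.PDE.EvansKrylov

open Literature.Analysis.Calculus Literature.Analysis.PDE.ABP Literature.Analysis.PDE.KrylovSafonov
open Literature.Analysis.FunctionSpaces

/-- **Gilbarg–Trudinger Theorem 17.14 (Evans–Krylov), interior a-priori `C^{2,α}` estimate in
coordinate-jet form, constants first.** See the module docstring for the hypotheses; the
conclusion is the Hölder continuity of `D²u` on the half ball with exponent and constant
depending only on `n, λ, Λ, μ, K, R₀, δ₀` (and the parameter space `P`).
[cite: GilbargTrudinger2001, Theorem 17.14] -/
theorem evansKrylov_interior_holder (ι : Type*) [Fintype ι] [DecidableEq ι] [Nonempty ι]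
    (P : Type*) [NormedAddCommGroup P] [NormedSpace ℝ P] {lam Λ μ K R₀ δ₀ : ℝ}
    (hlam : 0 < lam) (hΛ : lam ≤ Λ) (hμ : 0 ≤ μ) (hK : 0 ≤ K) (hR₀ : 0 < R₀) (hδ₀ : 0 < δ₀) :
    ∃ α : ℝ≥0, 0 < α ∧ α < 1 ∧ ∃ B : ℝ≥0,
      ∀ {O : Set (EuclideanSpace ℝ ι)}, IsOpen O →
      ∀ {u : EuclideanSpace ℝ ι → ℝ}, ContDiffOn ℝ 4 u O →
      ∀ {F : EuclideanSpace ℝ ι × P × CJet ι 2 → ℝ} {θ : P},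
        ContDiffOn ℝ 2 F {x | x.1 ∈ O} →
        (∀ y ∈ O, F (y, θ, cjetOf (EuclideanSpace.basisFun ι ℝ) 2 u y) = 0) →
      ∀ {y₀ : EuclideanSpace ℝ ι}, closedBall y₀ R₀ ⊆ O →
        (∀ y ∈ closedBall y₀ R₀, ∀ m ≤ 2, ‖iteratedFDeriv ℝ m u y‖ ≤ K) →
        (∀ z ∈ closedBall y₀ R₀, ∀ J : CJet ι 2, ‖J‖ ≤ K → ‖fderiv ℝ F (z, θ, J)‖ ≤ μ) →
        (∀ y ∈ closedBall y₀ R₀,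
          ‖fderiv ℝ (fderiv ℝ F) (y, θ, cjetOf (EuclideanSpace.basisFun ι ℝ) 2 u y)‖ ≤ μ) →
        (∀ y ∈ closedBall y₀ R₀, ∀ ξ : ι → ℝ,
          lam * (ξ ⬝ᵥ ξ) ≤
              fderiv ℝ F (y, θ, cjetOf (EuclideanSpace.basisFun ι ℝ) 2 u y)
                ((0 : EuclideanSpace ℝ ι), (0 : P), topJet (fun I ↦ ξ (I 0) * ξ (I 1))) ∧
            fderiv ℝ F (y, θ, cjetOf (EuclideanSpace.basisFun ι ℝ) 2 u y)
                ((0 : EuclideanSpace ℝ ι), (0 : P), topJet (fun I ↦ ξ (I 0) * ξ (I 1))) ≤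
              Λ * (ξ ⬝ᵥ ξ)) →
        (∀ y ∈ closedBall y₀ R₀, ∀ Ω : (Fin 2 → ι) → ℝ, (∀ i j, Ω ![i, j] = Ω ![j, i]) →
          fderiv ℝ (fderiv ℝ F) (y, θ, cjetOf (EuclideanSpace.basisFun ι ℝ) 2 u y)
            ((0 : EuclideanSpace ℝ ι), (0 : P), topJet Ω)
            ((0 : EuclideanSpace ℝ ι), (0 : P), topJet Ω) ≤ 0) →
        (∀ x ∈ closedBall y₀ R₀, ∀ y ∈ closedBall y₀ R₀, dist x y ≤ δ₀ →
          F (y, θ, cjetOf (EuclideanSpace.basisFun ι ℝ) 2 u y +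
              topJet (cjetOf (EuclideanSpace.basisFun ι ℝ) 2 u x (Fin.last 2) -
                cjetOf (EuclideanSpace.basisFun ι ℝ) 2 u y (Fin.last 2))) -
            F (y, θ, cjetOf (EuclideanSpace.basisFun ι ℝ) 2 u y) ≤
          fderiv ℝ F (y, θ, cjetOf (EuclideanSpace.basisFun ι ℝ) 2 u y)
            ((0 : EuclideanSpace ℝ ι), (0 : P),
              topJet (cjetOf (EuclideanSpace.basisFun ι ℝ) 2 u x (Fin.last 2) -
                cjetOf (EuclideanSpace.basisFun ι ℝ) 2 u y (Fin.last 2)))) →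
      HolderOnWith B α (iteratedFDeriv ℝ 2 u) (ball y₀ (R₀ / 2)) := by
  classical
  set bE := EuclideanSpace.basisFun ι ℝ with hbE
  set n : ℝ := (Fintype.card ι : ℝ) with hn
  have hn1 : (1 : ℝ) ≤ n := by rw [hn]; exact_mod_cast Fintype.card_pos
  have hn0 : 0 ≤ n := zero_le_one.trans hn1
  -- ### the constants
  -- the Evans–Krylov directions
  obtain ⟨N, γ, lamS, ΛS, hlamS, hΛS, hγunit, hdiag, hoff, hMW⟩ := exists_ek_directions ι hlam hΛ
  haveI : Nonempty (Fin N) := by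
    obtain ⟨i⟩ := ‹Nonempty ι›
    obtain ⟨k, -⟩ := hdiag i
    exact ⟨k⟩
  -- the differentiated inequality, the supersolutions, the coupling, the decay
  set M₂ : ℝ := n * K with hM₂
  have hM₂0 : 0 ≤ M₂ := mul_nonneg hn0 hK
  obtain ⟨A₀, B₀, hA₀, hB₀, hA1⟩ := pair_symbolMatrix_hessian_quadHess_ge ι P hμ hK
  obtain ⟨Φ₀, hΦ₀, hA1b⟩ := supersolution_w ι (Fin N) hlam hA₀ hB₀ hM₂0
  obtain ⟨D₀, hD₀, hA2⟩ := coupling_bound ι P hμ hK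
  obtain ⟨δ, C, hδ0, hδ1, hC0, hdecay⟩ := oscillation_decay ι (Fin N) hlam hΛ hlamS hΛS
  -- `ε`, the contraction factor `γ₀ = δ + C ε < 1`, the radius `R₁`, the linear rate `c₁`
  set ε : ℝ := min 1 ((1 - δ) / (2 * (C + 1))) with hε
  have hε0 : 0 < ε := lt_min one_pos (div_pos (by linarith) (by linarith))
  have hε1 : ε ≤ 1 := min_le_left _ _
  have hCε : C * ε ≤ (1 - δ) / 2 := by
    have h1 : ε ≤ (1 - δ) / (2 * (C + 1)) := min_le_right _ _
    have h2 : C * ε ≤ C * ((1 - δ) / (2 * (C + 1))) := mul_le_mul_of_nonneg_left h1 hC0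
    have h3 : C * ((1 - δ) / (2 * (C + 1))) ≤ (1 - δ) / 2 := by
      rw [mul_div_assoc', div_le_div_iff₀ (by linarith) (by norm_num : (0:ℝ) < 2)]
      nlinarith
    exact h2.trans h3
  set γ₀ : ℝ := δ + C * ε with hγ₀
  have hγ₀0 : 0 < γ₀ := add_pos_of_pos_of_nonneg hδ0 (mul_nonneg hC0 hε0.le)
  have hγ₀1 : γ₀ < 1 := by rw [hγ₀]; linarith
  obtain ⟨hτ0, hτsq, -⟩ := alphaWH_bounds (ι := ι)
  have hτ1 : alphaWH ι < 1 := by nlinarith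
  obtain ⟨α, hα0, hα1, hA4⟩ :=
    holderOnWith_of_oscSum_decay ι (Fin N) hτ0 hτ1 hγ₀0 hγ₀1
  set R₁ : ℝ := min (R₀ / 2) (δ₀ / 2) with hR₁
  have hR₁0 : 0 < R₁ := lt_min (half_pos hR₀) (half_pos hδ₀)
  have hR₁R₀ : R₁ ≤ R₀ / 2 := min_le_left _ _
  have hR₁δ₀ : R₁ ≤ δ₀ / 2 := min_le_right _ _
  set D₁ : ℝ := D₀ / (1 + M₂) with hD₁
  have hD₁0 : 0 ≤ D₁ := div_nonneg hD₀ (by linarith)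
  set c₁ : ℝ := C * (D₁ + Φ₀ / ε * R₁) with hc₁
  have hc₁0 : 0 ≤ c₁ :=
    mul_nonneg hC0 (add_nonneg hD₁0 (mul_nonneg (div_nonneg hΦ₀ hε0.le) hR₁0.le))
  obtain ⟨Bh, hBh⟩ := hA4 hc₁0 hR₁0
  -- the final constant
  refine ⟨α, hα0, hα1, (Fintype.card ι) ^ 2 * (‖(2 : ℝ) * (1 + M₂)‖₊ * Bh), ?_⟩
  -- ### the data
  intro O hO u hu F θ hF heq y₀ hBO hKb hμ1 hμ2 hell hconc hhyb
  have hu2 : ContDiffOn ℝ 2 u O := hu.of_le (by norm_num)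
  have huat : ∀ y ∈ O, ContDiffAt ℝ 4 u y := fun y hy ↦ hu.contDiffAt (hO.mem_nhds hy)
  have hu2at : ∀ y ∈ O, ContDiffAt ℝ 2 u y := fun y hy ↦ (huat y hy).of_le (by norm_num)
  have hF1 : ContDiffOn ℝ 1 F {x | x.1 ∈ O} := hF.of_le (by norm_num)
  have hball : ball y₀ R₀ ⊆ O := ball_subset_closedBall.trans hBO
  -- the symbol matrices `a y`
  set a : EuclideanSpace ℝ ι → Matrix ι ι ℝ := fun y ↦ symbolMatrix F (y, θ, cjetOf bE 2 u y)
    with ha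
  have ha_symm : ∀ y, (a y).IsSymm := fun y ↦ symbolMatrix_isSymm F _
  have ha_low : ∀ y ∈ closedBall y₀ R₀, ∀ ξ : ι → ℝ, lam * (ξ ⬝ᵥ ξ) ≤ ξ ⬝ᵥ (a y *ᵥ ξ) :=
    fun y hy ξ ↦ by rw [ha, dotProduct_symbolMatrix_mulVec]; exact (hell y hy ξ).1
  have ha_up : ∀ y ∈ closedBall y₀ R₀, ∀ ξ : ι → ℝ, ξ ⬝ᵥ (a y *ᵥ ξ) ≤ Λ * (ξ ⬝ᵥ ξ) :=
    fun y hy ξ ↦ by rw [ha, dotProduct_symbolMatrix_mulVec]; exact (hell y hy ξ).2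
  -- the Motzkin–Wasow weights
  have hβex : ∀ y ∈ closedBall y₀ R₀, ∃ β : Fin N → ℝ, (∀ k, lamS ≤ β k ∧ β k ≤ ΛS) ∧
      a y = ∑ k, β k • vecMulVec (γ k) (γ k) := fun y hy ↦
    hMW (a y) (ha_symm y) (ha_low y hy) (ha_up y hy)
  choose! β hβb hβa using hβex
  -- ### the normalised pure second derivatives `h_k`
  set q : Fin N → EuclideanSpace ℝ ι → ℝ := fun k z ↦ quadHess u (γ k) z with hq
  set h : Fin N → EuclideanSpace ℝ ι → ℝ := fun k z ↦ (1 + q k z / (1 + M₂)) / 2 with hh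
  have hM₂1 : 0 < 1 + M₂ := by linarith
  have hM₂ne : (1 + M₂) ≠ 0 := ne_of_gt hM₂1
  have hqbd : ∀ k, ∀ z ∈ closedBall y₀ R₀, |q k z| ≤ M₂ := fun k z hz ↦ by
    have h1 := abs_quadHess_le u (hγunit k) z
    exact h1.trans (mul_le_mul_of_nonneg_left (hKb z hz 2 le_rfl) hn0)
  have h01 : ∀ k, ∀ z ∈ closedBall y₀ R₀, 0 ≤ h k z ∧ h k z ≤ 1 := fun k z hz ↦ by
    have h1 := hqbd k z hz
    rw [abs_le] at h1
    have h2 : -1 ≤ q k z / (1 + M₂) := by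
      rw [le_div_iff₀ hM₂1]; linarith
    have h3 : q k z / (1 + M₂) ≤ 1 := by
      rw [div_le_iff₀ hM₂1]; linarith
    simp only [hh]
    constructor <;> linarith
  have hhC2 : ∀ k, ContDiffOn ℝ 2 (h k) O := fun k ↦ by
    show ContDiffOn ℝ 2 (fun z ↦ (1 + quadHess u (γ k) z / (1 + M₂)) / 2) O
    exact (contDiffOn_const.add ((contDiffOn_quadHess hO hu (γ k)).div_const _)).div_const _
  have hhmeas : ∀ k, Measurable (h k) := fun k ↦ by
    show Measurable (fun z ↦ (1 + quadHess u (γ k) z / (1 + M₂)) / 2)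
    exact (measurable_const.add ((measurable_quadHess u (γ k)).div_const _)).div_const _
  -- `h_k(y) − h_k(x) = (q_k(y) − q_k(x)) / (2(1+M₂))`
  have hhsub : ∀ k x y, h k y - h k x = (q k y - q k x) / (2 * (1 + M₂)) := fun k x y ↦ by
    simp only [hh]
    field_simp
    ring
  -- ### the supersolution property at every point of the closed ball
  have hsuper : ∀ k, ∀ y ∈ closedBall y₀ R₀,
      -(Φ₀ / ε) ≤ pair (a y) (hessianMatrix (fun x ↦ h k x + ε * ∑ l, h l x ^ 2) bE y) := by
    intro k y hy
    have hyO : y ∈ O := hBO hy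
    have hjet : ‖cjetOf bE 2 u y‖ ≤ K :=
      norm_cjetOf_le bE 2 u y (fun j hj ↦ hKb y hy j hj) hK
    have hineq : ∀ l, -(A₀ * Real.sqrt (thirdSq u y) + B₀) ≤
        pair (a y) (hessianMatrix (quadHess u (γ l)) bE y) := fun l ↦
      hA1 hO hu hF heq hyO (hKb y hy) (hμ1 y hy _ hjet) (hμ2 y hy) (hconc y hy) (γ l)
        (hγunit l)
    have hK2 : ‖iteratedFDeriv ℝ 2 u y‖ ≤ M₂ :=
      (hKb y hy 2 le_rfl).trans (le_mul_of_one_le_left hK hn1)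
    exact hA1b hO hu hyO hK2 (ha_low y hy) hγunit hdiag hoff hineq hε0 hε1 k
  -- ### the oscillation decay at every centre of the half ball
  have hdec : ∀ y₁ ∈ ball y₀ (R₀ / 2), ∀ R ∈ Ioc 0 R₁,
      oscSum h y₁ (alphaWH ι * R) ≤ γ₀ * oscSum h y₁ R + c₁ * R := by
    intro y₁ hy₁ R hR
    obtain ⟨hR0, hRR₁⟩ := hR
    -- the ball `B̄(y₁, R)` inside the big closed ball
    have hsubC : closedBall y₁ R ⊆ closedBall y₀ R₀ := by
      intro z hz
      rw [mem_closedBall] at hz ⊢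
      rw [mem_ball] at hy₁
      have := dist_triangle z y₁ y₀
      linarith
    have hsubB : ball y₁ R ⊆ closedBall y₀ R₀ := ball_subset_closedBall.trans hsubC
    have hsubO : closedBall y₁ R ⊆ O := hsubC.trans hBO
    -- the coupling on `B(y₁, R)`
    have hcoup : ∀ x ∈ ball y₁ R, ∀ y ∈ ball y₁ R,
        ∑ k, β y k * (h k y - h k x) ≤ D₁ * R := by
      intro x hx y hy
      have hxC := hsubB hx
      have hyC := hsubB hy
      have hxy : dist x y ≤ δ₀ := by
        have h1 : dist x y ≤ dist x y₁ + dist y y₁ := dist_triangle_right x y y₁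
        rw [mem_ball] at hx hy
        linarith
      have hsum : ∑ k, β y k * (h k y - h k x) =
          (∑ k, β y k * (q k y - q k x)) / (2 * (1 + M₂)) := by
        rw [Finset.sum_div]
        refine Finset.sum_congr rfl fun k _ ↦ ?_
        rw [hhsub, mul_div_assoc]
      have hid := sum_mul_quadHess_sub_eq_fderiv (F := F) (θ := θ) (hu2at x (hBO hxC))
        (hu2at y (hBO hyC)) (hβa y hyC)
      have hbound := hA2 hO hu2 hF1 hBO (fun z hz ↦ heq z (hBO hz)) hKb hμ1 hhyb x hxC y hyC hxy
      have hdist : dist x y ≤ 2 * R := by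
        have h1 : dist x y ≤ dist x y₁ + dist y y₁ := dist_triangle_right x y y₁
        rw [mem_ball] at hx hy
        linarith
      rw [hsum, div_le_iff₀ (by linarith)]
      show ∑ k, β y k * (quadHess u (γ k) y - quadHess u (γ k) x) ≤ D₁ * R * (2 * (1 + M₂))
      rw [hid]
      calc _ ≤ D₀ * dist x y := hbound
        _ ≤ D₀ * (2 * R) := mul_le_mul_of_nonneg_left hdist hD₀
        _ = D₁ * R * (2 * (1 + M₂)) := by rw [hD₁]; field_simp
    -- the decay inequality
    have key := hdecay hO hR0 hsubO (fun y _ ↦ ha_symm y) (fun y hy ↦ ha_low y (hsubB hy))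
      (fun y hy ↦ ha_up y (hsubB hy)) hhC2 hhmeas (fun k y hy ↦ h01 k y (hsubC hy)) hε0 hε1
      (div_nonneg hΦ₀ hε0.le) (fun k y hy ↦ hsuper k y (hsubB hy))
      (fun y hy k ↦ hβb y (hsubB hy) k) hD₁0 hcoup
    -- `δ ω + C(ε ω + D₁ R + (Φ₀/ε) R²) ≤ (δ + Cε) ω + C (D₁ + (Φ₀/ε) R₁) R`
    have hω0 : 0 ≤ oscSum h y₁ R := oscSum_nonneg hR0 le_rfl (fun k z hz ↦ h01 k z (hsubC hz))
    have hR2 : R ^ 2 ≤ R₁ * R := by nlinarith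
    have hΦε : 0 ≤ Φ₀ / ε := div_nonneg hΦ₀ hε0.le
    calc oscSum h y₁ (alphaWH ι * R)
        ≤ δ * oscSum h y₁ R + C * (ε * oscSum h y₁ R + D₁ * R + Φ₀ / ε * R ^ 2) := key
      _ ≤ δ * oscSum h y₁ R + C * (ε * oscSum h y₁ R + D₁ * R + Φ₀ / ε * (R₁ * R)) := by
          gcongr
      _ = γ₀ * oscSum h y₁ R + c₁ * R := by rw [hγ₀, hc₁]; ring
  -- ### Hölder continuity of the `h_k`, of the `q_k`, of `D²u`
  have hhH : ∀ k, HolderOnWith Bh α (h k) (ball y₀ (R₀ / 2)) :=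
    hBh hR₁R₀ (fun k z hz ↦ h01 k z (ball_subset_closedBall hz)) hdec
  have hqH : ∀ k, HolderOnWith (‖(2 : ℝ) * (1 + M₂)‖₊ * Bh) α (quadHess u (γ k))
      (ball y₀ (R₀ / 2)) := by
    intro k
    have h1 := (hhH k).const_mul ((2 : ℝ) * (1 + M₂))
    intro x hx y hy
    have h2 := h1 x hx y hy
    have h3 : ∀ z, (2 : ℝ) * (1 + M₂) * h k z = quadHess u (γ k) z + (1 + M₂) := fun z ↦ by
      simp only [hh, hq]
      field_simp
      ring
    simp only [h3, edist_add_right] at h2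
    exact h2
  have hsymm : ∀ y ∈ ball y₀ (R₀ / 2), (hessianMatrix u bE y).IsSymm := fun y hy ↦
    hessianMatrix_isSymm (hu2at y (hball (ball_subset_ball (half_le_self hR₀.le) hy)))
  exact holderOnWith_iteratedFDeriv_two_of_quadHess hsymm hdiag hoff hqH

end Literature.Analysis.PDE.EvansKrylov

end
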